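import Literature.MathematicalPhysics.QuantumFieldTheory.ConformalBootstrap3D.PointKernelLowerM
import Literature.MathematicalPhysics.QuantumFieldTheory.ConformalBootstrap3D.SingleCorrelatorNonVacuity

/-!
# σ-form of the LOWER-box kernel theorems

`SigmaBoxExcluded Q` (exclusion over the single-correlator class `SatisfiesSigmaAxioms`,
`SingleCorrelatorNonVacuity`) is the stronger conclusion the global enclosure programme
(`IsingEnclosureGlobal.GlobalCertificates`) consumes.  Exactly as `PointKernelSigma` did for the
unbounded box, this file re-derives the LOWER-box chain of `PointKernelLower` / `PointKernelLowerM`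
with the final step `SingleCorrelatorObligations.boxExcluded` replaced by
`SingleCorrelatorObligations.sigmaBoxExcluded`; every hypothesis list is verbatim, so a landed
instance `PCert.boxExcluded_of_kernelC_lowerSM …` becomes σ-form by changing the head symbol:

* `sigmaBoxExcluded_of_pointRules_twistI` — σ-version of `boxExcluded_of_pointRules_twistI`;
* `sigmaBoxExcluded_of_pointTable₂SEM` — σ-version of `boxExcluded_of_pointTable₂SEM`;
* `PCert.sigmaBoxExcluded_of_kernelC_lowerSM` — σ-version of `PCert.boxExcluded_of_kernelC_lowerSM`.

References: the sum rule and linear-functional method [cite: HogervorstRychkov2013, §3 eq. (3.6)];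
single-correlator axioms [cite: KosPolandSimmonsduffin2014, §3.3 eq. (3.16)].
-/

noncomputable section

namespace Literature.MathematicalPhysics.QuantumFieldTheory.ConformalBootstrap3D

open Literature.Analysis.ValidatedNumerics (rall of_rall)
open Real Finset Set

/-! ### The rule schema and the two-row lower table, σ-versions -/

/-- **σ-version of `boxExcluded_of_pointRules_twistI`**: the same hypotheses (point-functional schema,
twist domain, (O1) on `Q` itself) prove `SigmaBoxExcluded Q`, exclusion over the single-correlator class
`SatisfiesSigmaAxioms`, through `SingleCorrelatorObligations.sigmaBoxExcluded`.
[cite: HogervorstRychkov2013, §3 eq. (3.6)] -/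
theorem sigmaBoxExcluded_of_pointRules_twistI {N : ℕ} {w z zb : Fin N → ℝ}
    (hz : ∀ k, z k ∈ Ioo (0 : ℝ) 1) (hzb : ∀ k, zb k ∈ Ioo (0 : ℝ) 1) (hord : ∀ k, zb k ≤ z k)
    (a : Fin N) (ha : 0 ≤ w a) (qd qr : Fin N → ℝ) (hqd : ∀ k, 0 < qd k ∧ qd k ≤ 1)
    (hqr : ∀ k, 0 < qr k ∧ qr k ≤ 1)
    (hdomd : ∀ k, z k * zb k ≤ qd k ^ 2 * (z a * zb a) ∧ z k ≤ qd k * z a)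
    (hdomr : ∀ k, (1 - z k) * (1 - zb k) ≤ qr k ^ 2 * (z a * zb a) ∧ 1 - zb k ≤ qr k * z a)
    {Q : Set (ℝ × ℝ)} {slo shi E₀ ET τ : ℝ} (hQ : ∀ p ∈ Q, slo ≤ p.1 ∧ p.1 ≤ shi)
    (hτ1 : τ ≤ 1) (hτ0 : τ ≤ E₀)
    (hI : ∀ p ∈ Q, 0 < pointFunctional w z zb (crossF p.1 (-1) (fun _ _ => (1 : ℝ))))
    (hO2 : ∀ p ∈ Q, BlockPositive (pointFunctional w z zb) p.1 p.2 0)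
    (hO3 : ∀ p ∈ Q, ∀ Δ : ℝ, 3 ≤ Δ → Δ < E₀ → BlockPositive (pointFunctional w z zb) p.1 Δ 0)
    (hO4 : ∀ p ∈ Q, ∀ ℓ : ℕ, Even ℓ → ℓ ≠ 0 → ∀ Δ : ℝ, (ℓ : ℝ) + 1 ≤ Δ → Δ < E₀ →
      BlockPositive (pointFunctional w z zb) p.1 Δ ℓ)
    (hM : ∀ (j : ℕ) (E : ℝ), E₀ ≤ E → E < ET → (j : ℝ) + τ ≤ E → ∀ p ∈ Q,
      0 ≤ pointFunctional w z zb (crossF p.1 (-1) (zMono E j)))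
    (hB : ∑ k ∈ univ.erase a, |w k| * ((1 - z k) * (1 - zb k)) ^ slo * qd k ^ ET
          + ∑ k, |w k| * (z k * zb k) ^ slo * qr k ^ ET ≤ w a * ((1 - z a) * (1 - zb a)) ^ shi) :
    SigmaBoxExcluded Q :=
  SingleCorrelatorObligations.sigmaBoxExcluded (Δstar := E₀) hz hzb
    { identity_pos := hI
      epsilon_nonneg := hO2
      scalar_nonneg := hO3
      spinning_nonneg := hO4
      tail_nonneg := fun p hp ℓ _ Δ hbd hΔ0 =>
        tail_nonneg_pointFunctional_of_termwise_and_apex_twist w z zb hz hzb hord a ha qd qr hqd hqr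
          hdomd hdomr hQ hτ1 hτ0 hM hB p hp ℓ Δ hbd hΔ0 }

/-- **σ-version of `boxExcluded_of_pointTable₂SEM`** (two-row LOWER-box table: ε-row by the interval rule,
scalar / spinning rows by the monotone rule, every head cell `s`-covered in existential form, (M) on `s`-pieces,
(O1) direct): the hypothesis list verbatim; conclusion `SigmaBoxExcluded Q`.
[cite: HogervorstRychkov2013, §3 eq. (3.6)] -/
theorem sigmaBoxExcluded_of_pointTable₂SEM {N : ℕ} {w z zb : Fin N → ℝ}
    (hz : ∀ k, z k ∈ Ioo (0 : ℝ) 1) (hzb : ∀ k, zb k ∈ Ioo (0 : ℝ) 1) (hord : ∀ k, zb k ≤ z k)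
    (apex : Fin N) (hapex : 0 ≤ w apex) (qd qr : Fin N → ℝ) (hqd : ∀ k, 0 < qd k ∧ qd k ≤ 1)
    (hqr : ∀ k, 0 < qr k ∧ qr k ≤ 1)
    (hdomd : ∀ k, z k * zb k ≤ qd k ^ 2 * (z apex * zb apex) ∧ z k ≤ qd k * z apex)
    (hdomr : ∀ k, (1 - z k) * (1 - zb k) ≤ qr k ^ 2 * (z apex * zb apex) ∧
      1 - zb k ≤ qr k * z apex)
    {Q : Set (ℝ × ℝ)} {slo shi εlo εhi E₀ ET τ : ℝ}
    (t : ℕ → ℕ → ℝ) (K : ℕ → ℕ) (nF : ℕ → ℕ → ℕ) (hc : ℕ → ℕ → Bool)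
    (tε : ℕ → ℝ) (Kε : ℕ) (nFε : ℕ → ℕ) (hcε : ℕ → Bool)
    (hQ : ∀ p ∈ Q, (slo ≤ p.1 ∧ p.1 ≤ shi) ∧
      ((εlo ≤ p.2 ∧ p.2 < εhi) ∨ (t 0 0 ≤ p.2 ∧ p.2 < E₀)))
    (L : ℕ) (hL : E₀ ≤ (L : ℝ) + 1) (hτ1 : τ ≤ 1) (hτ0 : τ ≤ E₀)
    (hr : ∀ k, 1 / 2 ≤ ((1 - z k) * (1 - zb k)) ^ (shi - slo) ∧ 1 / 2 ≤ (z k * zb k) ^ (shi - slo))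
    -- (O1), on `Q` itself
    (hI : ∀ p ∈ Q, 0 < pointFunctional w z zb (crossF p.1 (-1) (fun _ _ => (1 : ℝ))))
    -- the ε-row (ℓ = 0), interval rule, s-covered
    (htε : tε 0 = εlo ∧ tε Kε = εhi)
    (hlowε : ∀ k, k < Kε → 1 / 2 < tε k ∧ τ ≤ tε k)
    (hnFε : ∀ k, k < Kε → E₀ ≤ tε k + ((nFε k : ℝ) + 1))
    (hρε : ∀ k, k < Kε → hcε k = true → ∀ i, 1 / 2 ≤ (z i * zb i) ^ ((tε (k + 1) - tε k) / 2) ∧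
      1 / 2 ≤ ((1 - z i) * (1 - zb i)) ^ ((tε (k + 1) - tε k) / 2))
    (hheadε : ∀ k < Kε,
      ∃ P : ℕ, ∃ σ : ℕ → ℝ, 0 < P ∧ σ 0 = slo ∧ σ P = shi ∧ (∀ i < P, σ i ≤ σ (i + 1)) ∧
        ∀ i < P, 0 ≤ headNumberI w z zb 0 (tε k) (tε (k + 1)) (σ i) (σ (i + 1)) (nFε k) (hcε k))
    -- the scalar row (ℓ = 0, from ≤ 3 to E₀) and the spinning rows, monotone rule, s-covered
    (ht0 : t 0 0 ≤ 3 ∧ t 0 (K 0) = E₀)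
    (htℓ : ∀ ℓ, Even ℓ → ℓ ≠ 0 → ℓ < L → t ℓ 0 = (ℓ : ℝ) + 1 ∧ t ℓ (K ℓ) = E₀)
    (hlow : ∀ ℓ k, k < K ℓ → (ℓ : ℝ) + 1 ≤ t ℓ k)
    (hnF : ∀ ℓ k, k < K ℓ → E₀ ≤ t ℓ k + ((nF ℓ k : ℝ) + 1))
    (hρ : ∀ ℓ k, k < K ℓ → hc ℓ k = true → ∀ i, 1 / 2 ≤ (z i * zb i) ^ ((t ℓ (k + 1) - t ℓ k) / 2) ∧
      1 / 2 ≤ ((1 - z i) * (1 - zb i)) ^ ((t ℓ (k + 1) - t ℓ k) / 2))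
    (hhead : ∀ ℓ, (ℓ = 0 ∨ (Even ℓ ∧ ℓ < L)) → ∀ k < K ℓ,
      ∃ P : ℕ, ∃ σ : ℕ → ℝ, 0 < P ∧ σ 0 = slo ∧ σ P = shi ∧ (∀ i < P, σ i ≤ σ (i + 1)) ∧
        ∀ i < P, 0 ≤ headNumber w z zb ℓ (t ℓ k) (t ℓ (k + 1)) (σ i) (σ (i + 1)) (nF ℓ k) (hc ℓ k))
    -- (M), termwise
    (hM : ∀ (j : ℕ) (E : ℝ), E₀ ≤ E → E < ET → (j : ℝ) + τ ≤ E → ∀ p ∈ Q,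
      0 ≤ pointFunctional w z zb (crossF p.1 (-1) (zMono E j)))
    -- (T)
    (hB : ∑ k ∈ univ.erase apex, |w k| * ((1 - z k) * (1 - zb k)) ^ slo * qd k ^ ET
          + ∑ k, |w k| * (z k * zb k) ^ slo * qr k ^ ET ≤
          w apex * ((1 - z apex) * (1 - zb apex)) ^ shi) :
    SigmaBoxExcluded Q := by
  have hQ1 : ∀ p ∈ Q, slo ≤ p.1 ∧ p.1 ≤ shi := fun p hp => (hQ p hp).1
  -- every cell of the scalar and spinning rows (monotone coefficient bit)
  have hcell : ∀ ℓ, (ℓ = 0 ∨ (Even ℓ ∧ ℓ < L)) → ∀ k < K ℓ, ∀ p ∈ Q,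
      ∀ Δ ∈ Ico (t ℓ k) (t ℓ (k + 1)), BlockPositive (pointFunctional w z zb) p.1 Δ ℓ := by
    intro ℓ hℓ k hk
    obtain ⟨P, σ, hP, hσ0, hσP, hmono, hnum⟩ := hhead ℓ hℓ k hk
    exact cell_of_headNumber₂_scover w z zb hz hzb hord apex hapex qd qr hqd hqr hdomd hdomr hQ1 hτ1
      hM hB hr (nF ℓ k) (hnF ℓ k hk) (hc ℓ k) false (fun _ => hlow ℓ k hk) (fun h => absurd h (by simp))
      (hρ ℓ k hk) σ P hP hσ0 hσP hmono
      (fun i hi => by simpa [headNumber₂] using hnum i hi)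
  -- every cell of the ε-row (interval coefficient bit)
  have hb0 : unitarityBound3D 0 = 1 / 2 := by simp [unitarityBound3D]
  have hcellε : ∀ k < Kε, ∀ p ∈ Q,
      ∀ Δ ∈ Ico (tε k) (tε (k + 1)), BlockPositive (pointFunctional w z zb) p.1 Δ 0 := by
    intro k hk
    obtain ⟨P, σ, hP, hσ0, hσP, hmono, hnum⟩ := hheadε k hk
    exact cell_of_headNumber₂_scover w z zb hz hzb hord apex hapex qd qr hqd hqr hdomd hdomr hQ1 hτ1
      hM hB hr (nFε k) (hnFε k hk) (hcε k) true (fun h => absurd h (by simp))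
      (fun _ => by
        obtain ⟨h1, h2⟩ := hlowε k hk
        exact ⟨by rw [hb0]; exact h1, by simpa using h2⟩)
      (hρε k hk) σ P hP hσ0 hσP hmono
      (fun i hi => by simpa [headNumber₂] using hnum i hi)
  refine sigmaBoxExcluded_of_pointRules_twistI hz hzb hord apex hapex qd qr hqd hqr hdomd hdomr hQ1 hτ1 hτ0
    hI ?_ ?_ ?_ hM hB
  · -- (O2): `Δ_ε` lies in the ε-row or in the scalar row
    intro p hp
    rcases (hQ p hp).2 with hε | h0
    · exact blockPositive_of_cells_Ico tε Kε hcellε p hp p.2 ⟨htε.1 ▸ hε.1, htε.2 ▸ hε.2⟩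
    · exact blockPositive_of_cells_Ico (t 0) (K 0) (hcell 0 (Or.inl rfl)) p hp p.2
        ⟨h0.1, ht0.2 ▸ h0.2⟩
  · -- (O3)
    exact scalar_nonneg_of_cells (t 0) (K 0) ht0.1 ht0.2 (hcell 0 (Or.inl rfl))
  · -- (O4)
    exact spinning_nonneg_of_cells L hL t K (fun ℓ hev hℓ hℓL => (htℓ ℓ hev hℓ hℓL).1.le)
      (fun ℓ hev hℓ hℓL => (htℓ ℓ hev hℓ hℓL).2)
      (fun ℓ hev hℓ hℓL => hcell ℓ (Or.inr ⟨hev, hℓL⟩))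

namespace PointKernel

namespace PCert

variable {c : PCert}

/-- **σ-version of the kernel certificate theorem for the LOWER box with (M) on `s`-pieces**: the
hypothesis list of `PCert.boxExcluded_of_kernelC_lowerSM` verbatim; conclusion
`SigmaBoxExcluded ([s_lo, s_hi] × [ε_lo, ε_hi))`, so that a landed lower-box instance upgrades to the
σ-form by swapping the head symbol of its final proof term. [folklore] -/
theorem sigmaBoxExcluded_of_kernelC_lowerSM (hc : c.checkNodes = true) (hside : c.sideOK = true)
    (KI : ℕ) (σI : ℕ → ℚ) (hKI : 0 < KI) (hσI0 : σI 0 = c.slo) (hσIK : σI KI = c.shi)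
    (hIrow : ∀ i < KI, ∀ s ∈ Icc ((σI i : ℚ) : ℝ) ((σI (i + 1) : ℚ) : ℝ),
      0 < pointFunctional c.wR c.zR c.zbR (crossF s (-1) (fun _ _ => (1 : ℝ))))
    (qd qr : List ℚ) (ET : ℕ) (hT : c.tOK qd qr ET = true)
    (εlo εhi t00 E0 τ : ℚ) (L J : ℕ) (hpar : paramOK t00 E0 τ L ET J = true)
    (esegs : List HSeg) (hmetaE : eMetaOK c.rho esegs εlo εhi E0 τ = true)
    (hsegs : List HSeg) (hmetaH : hMetaOK c.rho hsegs t00 E0 L = true)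
    (KM : ℕ) (σM : ℕ → ℚ) (hKM : 0 < KM) (hσM0 : σM 0 = c.slo) (hσMK : σM KM = c.shi)
    (mrowsP : ℕ → List MRow) (hmetaM : ∀ i < KM, c.mMetaOK (mrowsP i) E0 τ ET J = true)
    (hecells : ∀ i < esegs.length, ∀ x ∈ segCells c.rho (segAt esegs i), c.CellFactIS (segAt esegs i).ell x)
    (hcells : ∀ i < hsegs.length, ∀ x ∈ segCells c.rho (segAt hsegs i), c.CellFactS (segAt hsegs i).ell x)
    (hboxes : ∀ i < KM, ∀ j < J, ∀ m < (rowAt (mrowsP i) j).steps.length,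
      0 ≤ termCornerBound c.wR c.zR c.zbR j (c.eM (mrowsP i) j m) (c.eM (mrowsP i) j (m + 1))
        ((σM i : ℚ) : ℝ) ((σM (i + 1) : ℚ) : ℝ)) :
    SigmaBoxExcluded (QBoxL c.slo c.shi εlo εhi) := by
  simp only [paramOK, Bool.and_eq_true, decide_eq_true_eq] at hpar
  obtain ⟨⟨⟨⟨⟨h3, hL⟩, hτ1⟩, hτ0⟩, hJ⟩, hL0⟩ := hpar
  obtain ⟨hqd, hqr, hdomd, hdomr, hB⟩ := t_hyps hc qd qr ET hT
  obtain ⟨ht0, htℓ, hlow, hnF, hcell⟩ := head_hyps c.rho hsegs t00 E0 L hmetaH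
  obtain ⟨htε, hlowε, hnFε, hcellε⟩ := ehead_hyps c.rho esegs εlo εhi E0 τ hmetaE
  -- the facts of cell `k` of row `ℓ` / of the ε-row
  have hF : ∀ ℓ k, k < KH c.rho hsegs ℓ → c.CellFactS ℓ (cellAt c.rho hsegs ℓ k) := by
    intro ℓ k hk
    obtain ⟨-, -, i, hi, hell, hmem⟩ := hcell ℓ k hk
    have := hcells i hi _ hmem
    rwa [hell] at this
  have hFε : ∀ k, k < KH c.rho esegs 0 → c.CellFactIS 0 (cellAt c.rho esegs 0 k) := by
    intro k hk
    obtain ⟨-, -, i, hi, hell, hmem⟩ := hcellε k hk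
    have := hecells i hi _ hmem
    rwa [hell] at this
  have hhead : ∀ ℓ, (ℓ = 0 ∨ (Even ℓ ∧ ℓ < L)) → ∀ k < KH c.rho hsegs ℓ,
      ∃ P : ℕ, ∃ σ : ℕ → ℝ, 0 < P ∧ σ 0 = ((c.slo : ℚ) : ℝ) ∧ σ P = ((c.shi : ℚ) : ℝ) ∧
        (∀ i < P, σ i ≤ σ (i + 1)) ∧
        ∀ i < P, 0 ≤ headNumber c.wR c.zR c.zbR ℓ (tH c.rho hsegs ℓ k) (tH c.rho hsegs ℓ (k + 1))
          (σ i) (σ (i + 1)) (nFH c.rho hsegs ℓ k) (bH c.rho hsegs ℓ k) := by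
    intro ℓ _ k hk
    obtain ⟨e1, e2, -⟩ := hcell ℓ k hk
    obtain ⟨⟨P, σ, hP, hσ0, hσP, hmono, hnum⟩, -⟩ := hF ℓ k hk
    refine ⟨P, σ, hP, hσ0, hσP, hmono, fun i hi => ?_⟩
    rw [e1, e2, nFH, bH]
    exact hnum i hi
  have hheadε : ∀ k < KH c.rho esegs 0,
      ∃ P : ℕ, ∃ σ : ℕ → ℝ, 0 < P ∧ σ 0 = ((c.slo : ℚ) : ℝ) ∧ σ P = ((c.shi : ℚ) : ℝ) ∧
        (∀ i < P, σ i ≤ σ (i + 1)) ∧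
        ∀ i < P, 0 ≤ headNumberI c.wR c.zR c.zbR 0 (tH c.rho esegs 0 k) (tH c.rho esegs 0 (k + 1))
          (σ i) (σ (i + 1)) (nFH c.rho esegs 0 k) (bH c.rho esegs 0 k) := by
    intro k hk
    obtain ⟨e1, e2, -⟩ := hcellε k hk
    obtain ⟨⟨P, σ, hP, hσ0, hσP, hmono, hnum⟩, -⟩ := hFε k hk
    refine ⟨P, σ, hP, hσ0, hσP, hmono, fun i hi => ?_⟩
    rw [e1, e2, nFH, bH]
    exact hnum i hi
  have hρ : ∀ ℓ k, k < KH c.rho hsegs ℓ → bH c.rho hsegs ℓ k = true → ∀ i : Fin c.N,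
      1 / 2 ≤ (c.zR i * c.zbR i) ^ ((tH c.rho hsegs ℓ (k + 1) - tH c.rho hsegs ℓ k) / 2) ∧
      1 / 2 ≤ ((1 - c.zR i) * (1 - c.zbR i)) ^ ((tH c.rho hsegs ℓ (k + 1) - tH c.rho hsegs ℓ k) / 2) := by
    intro ℓ k hk hb i
    obtain ⟨e1, e2, -⟩ := hcell ℓ k hk
    rw [e1, e2]
    exact (hF ℓ k hk).2 hb i
  have hρε : ∀ k, k < KH c.rho esegs 0 → bH c.rho esegs 0 k = true → ∀ i : Fin c.N,
      1 / 2 ≤ (c.zR i * c.zbR i) ^ ((tH c.rho esegs 0 (k + 1) - tH c.rho esegs 0 k) / 2) ∧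
      1 / 2 ≤ ((1 - c.zR i) * (1 - c.zbR i)) ^ ((tH c.rho esegs 0 (k + 1) - tH c.rho esegs 0 k) / 2) := by
    intro k hk hb i
    obtain ⟨e1, e2, -⟩ := hcellε k hk
    rw [e1, e2]
    exact (hFε k hk).2 hb i
  have hJR : ((ET : ℕ) : ℝ) ≤ (J : ℝ) + ((τ : ℚ) : ℝ) := by
    have : (((ET : ℚ)) : ℝ) ≤ (((J : ℚ) + τ : ℚ) : ℝ) := by exact_mod_cast hJ
    push_cast at this; exact this
  -- (O1) from the identity pieces
  have hI : ∀ p ∈ QBoxL c.slo c.shi εlo εhi,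
      0 < pointFunctional c.wR c.zR c.zbR (crossF p.1 (-1) (fun _ _ => (1 : ℝ))) := by
    intro p hp
    obtain ⟨i, hi, hs⟩ := exists_piece_Icc (fun i => ((σI i : ℚ) : ℝ)) KI hKI p.1
      ⟨by simp only [hσI0]; exact hp.1.1, by simp only [hσIK]; exact hp.1.2⟩
    exact hIrow i hi p.1 hs
  -- (M) from the (M) pieces
  have hM := ruleM_of_cornerTables_pieces c.wR c.zR c.zbR (zR_mem hc) (zbR_mem hc)
    (Q := QBoxL c.slo c.shi εlo εhi) (E₀ := ((E0 : ℚ) : ℝ)) (ET := ((ET : ℕ) : ℝ)) ((τ : ℚ) : ℝ)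
    (fun p hp => hp.1) KM (fun i => ((σM i : ℚ) : ℝ)) hKM (by simp only [hσM0]) (by simp only [hσMK])
    (fun i => c.eM (mrowsP i)) (fun i j => (rowAt (mrowsP i) j).steps.length)
    (fun i hi => mMeta_hyps (mrowsP i) E0 τ ET J hJR (hmetaM i hi))
    (fun i hi j hj m hm => by
      have hjJ : j < J := by
        by_contra hcon
        push Not at hcon
        have : (J : ℝ) ≤ j := by exact_mod_cast hcon
        linarith
      exact hboxes i hi j hjJ m hm)
  refine sigmaBoxExcluded_of_pointTable₂SEM (w := c.wR) (z := c.zR) (zb := c.zbR)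
    (slo := ((c.slo : ℚ) : ℝ)) (shi := ((c.shi : ℚ) : ℝ)) (εlo := ((εlo : ℚ) : ℝ)) (εhi := ((εhi : ℚ) : ℝ))
    (E₀ := ((E0 : ℚ) : ℝ)) (ET := ((ET : ℕ) : ℝ)) (τ := ((τ : ℚ) : ℝ))
    (zR_mem hc) (zbR_mem hc) ?_ ⟨c.apex, apex_lt hc⟩ ?_ (c.qR qd) (c.qR qr) hqd hqr hdomd hdomr
    (tH c.rho hsegs) (KH c.rho hsegs) (nFH c.rho hsegs) (bH c.rho hsegs)
    (tH c.rho esegs 0) (KH c.rho esegs 0) (nFH c.rho esegs 0) (bH c.rho esegs 0)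
    (fun p hp => ⟨hp.1, Or.inl hp.2⟩) L (by exact_mod_cast hL) (by exact_mod_cast hτ1)
    (by exact_mod_cast hτ0) (side_hyp hside) hI htε hlowε hnFε hρε hheadε
    (⟨by rw [ht0.1]; exact_mod_cast h3, ht0.2⟩) htℓ hlow hnF hρ hhead hM hB
  · intro k
    have hn := checkNode_of_checkNodes hc k.2
    simpa [zR, zbR] using (show ((c.zb k : ℚ) : ℝ) ≤ ((c.z k : ℚ) : ℝ) by exact_mod_cast zb_le_z hn)
  · simpa [wR] using (show ((0 : ℚ) : ℝ) ≤ ((c.w c.apex : ℚ) : ℝ) by exact_mod_cast w_apex_nonneg hc)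

end PCert

end PointKernel

end Literature.MathematicalPhysics.QuantumFieldTheory.ConformalBootstrap3D
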